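import Summits.BirchSwinnertonDyer.Rank1Residual.Additive.KatoDescentRankOneCountJMatching
import HarnessLib

set_option autoImplicit false

/-!
# J-MATCHING OVER A ROW PREDICATE and ON THE CM ROWS: COUNT-H2|R ⟺ COUNT-X₀|R modulo {GZK, `thm12_4`, H2X} for every
# `R : WeierstrassCurve ℚ → ℕ → Prop`, instantiated at `R W p := W.HasCM` (seat `bsd-cm-prr-ty1` g13, cell `bsd-cm`; theorems
# only: no definition, no named fact, no instance, no `sorry`)

Part 36 of the seat's kernel cut of stub 3 `stub_rankOneCountReadingKato` of the Kato–Perrin-Riou skeletons v4 (cruxes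
stmt-BirchSwinnertonDyer-19945 / -19223); OFFER (C) of the seat (planner D546: fold into Part 35 if it fits — it did not, 394 l.).
Part 34 (`KatoDescentRankOneCountJMatching`) proved, on the ALL-ADDITIVE rows, COUNT-H2 ⟺ COUNT-X₀ modulo {GZK, `Kato2004.thm12_4`,
H2X}; its two proofs use the all-additive clause ONLY to feed the hypothesis display, so the equivalence holds over ANY row
predicate `R W p` put in that slot (no implication `R ⟹ all-additive` is needed):
* §1 `countH2_of_gzk_of_thm12_4_of_h2x_of_countX₀_of_rowPred (R)` ({GZK, `thm12_4`, H2X} + COUNT-X₀|R ⟹ COUNT-H2|R) and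
  `countX₀_of_gzk_of_thm12_4_of_countH2_of_rowPred (R)` ({GZK, `thm12_4`} + COUNT-H2|R ⟹ COUNT-X₀|R), where COUNT-H2|R / COUNT-X₀|R
  are Part 32's COUNT-H2 / Part 34's COUNT-X₀ with `R W p →` in the slot of the all-additive clause (Part 34 = the instance
  `R W p :=` the clause);
* §2 the CM instances **`countH2_cm_of_gzk_of_thm12_4_of_h2x_of_countX₀_cm`** and **`countX₀_cm_of_gzk_of_thm12_4_of_countH2_cm`**
  (`R W p := W.HasCM`; COUNT-H2|CM is Part 33's display verbatim, COUNT-X₀|CM is Part 35's `hX₀` of `rankOneCountReading_cm_of_facts`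
  verbatim) — so on the CM rows, modulo {GZK, `thm12_4`, H2X}: COUNT-X₀|CM ⟺ COUNT-H2|CM ⟺ COUNT-EC⁰|CM (Part 33), and Part 35's
  `rankOneCountReading_cm_of_facts` consumes COUNT-X₀|CM.
HONEST LABEL: theorems only; no stub or item is closed; nothing is registered; nothing is asserted on 19945 / 19223; H2X, `thm12_4`,
GZK are hypotheses; Kato's Main Conjecture and Perrin-Riou's conjecture are not touched; BSD is not proved for any curve.
References: [Kato2004Asterisque] Thm. 12.4 (p. 221), (14.9.1) (p. 239), (14.9.3) (p. 240), §14.14 (14.14.1)–(14.14.2) (p. 243),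
Lemma 14.15 (p. 244); [Greenberg1989] §0 pp. 101–102; [Imai1975] Theorem (p. 12); [SilvermanATAEC1994] proof of Thm. II.10.5 (p. 172).
-/

noncomputable section

open scoped Classical NumberField ContRepresentation

open WeierstrassCurve Field IsDedekindDomain NumberField CategoryTheory Literature.NumberTheory.EllipticCurves
  Literature.NumberTheory.EllipticCurves.Kato2004 Literature.NumberTheory.GaloisRepresentations
  Literature.NumberTheory.GaloisRepresentations.DiscreteGaloisModule Literature.NumberTheory.EllipticCurves.Kato2004.EulerSystemValues
  Literature.NumberTheory.EllipticCurves.IwasawaAlgebra Literature.NumberTheory.EllipticCurves.Rank1Residual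
open WeierstrassCurve (galH1Primary kummerMapTorsion)
open Summit.BirchSwinnertonDyer.Rank1Residual.X12.O11 Summit.BirchSwinnertonDyer.Rank1Residual
  Summit.BirchSwinnertonDyer.Rank1Residual.Additive.GlobalKummer
  Summit.BirchSwinnertonDyer.BirchSwinnertonDyer.Theorems.CongruentShaFreeCutKatoKummerLogTorsion
  Summit.BirchSwinnertonDyer.BirchSwinnertonDyer.Theorems.CongruentShaFreeCutKatoDescentDatumOfH2
  Summit.BirchSwinnertonDyer.BirchSwinnertonDyer.Theorems.TowerTorsionFiniteOrdinary
  Summit.BirchSwinnertonDyer.Rank1Residual.Additive.LocPKummer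

namespace Summit.BirchSwinnertonDyer.Rank1Residual.Additive.StrictCount

/-! ## §1 The two links of Part 34 over an arbitrary row predicate `R` -/

section RowPred

/-- **COUNT-H2|R ⟸ {GZK, `Kato2004.thm12_4`, H2X} + COUNT-X₀|R** for ANY row predicate `R : WeierstrassCurve ℚ → ℕ → Prop` in
the slot of the all-additive clause (Part 34's `countH2_of_gzk_of_thm12_4_of_h2x_of_countX₀` is the instance `R :=` that clause;
the proof is Part 34's, which touches the clause only to feed COUNT-X₀).  Per row: GZK ⟹ rank one; `thm12_4` ⟹ both `(·)_Γ`
finite; H2X supplies `(J₀, e₀)` over the given pin (Imai finiteness by the theorem p686208); Part 34 §2 transfers the count.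
[cite: Kato2004Asterisque, Thm. 12.4 (p. 221), (14.9.1) (p. 239), (14.9.3) (p. 240), §14.14 (14.14.1)–(14.14.2) (p. 243), Lemma 14.15 (p. 244)]
[cite: Imai1975, Theorem (p. 12)] [cite: Greenberg1989, §0 pp. 101–102] -/
theorem countH2_of_gzk_of_thm12_4_of_h2x_of_countX₀_of_rowPred (R : WeierstrassCurve ℚ → ℕ → Prop)
    (hGZK : rank_eq_analyticRank_of_analyticRank_le_one)
    (h12 : Kato2004.thm12_4) (hH2X : exists_iwasawaH2Data_fineSelmerDual_embedding)
    (hX₀ : ∀ (W : WeierstrassCurve ℚ) [W.IsElliptic] [W.IsGloballyMinimal] (p : ℕ) [Fact p.Prime],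
      letI : ContinuousSMul ℤ_[p] (W.tateModule p) := TateModule.continuousSMul_padicInt
      ∀ (κ : ZpExtension ℚ p) (γ : absoluteGaloisGroup ℚ), κ.IsCyclotomic → (hγ : κ.IsTopGenerator γ) →
        ∀ (I : IwasawaH1Data W p κ γ) (J₀ : IwasawaH2Data W p κ γ I)
          (e₀ : (W.fineSelmerDualData κ hγ).X →ₗ[IwasawaAlgebra p] J₀.H2),
          W.analyticRank = 1 → p ≠ 2 → Addv W p → 0 ≤ padicValRat p W.j → ¬ p ∣ W.torsionOrder → Finite W.sha →
          R W p →
          Function.Injective e₀ → Finite (J₀.H2 ⧸ LinearMap.range e₀) →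
          KatoH2CountAt W p (Nat.card (coinvariants p J₀.H2))) :
    ∀ (W : WeierstrassCurve ℚ) [W.IsElliptic] [W.IsGloballyMinimal] (p : ℕ) [Fact p.Prime],
      letI : ContinuousSMul ℤ_[p] (W.tateModule p) := TateModule.continuousSMul_padicInt
      ∀ (κ : ZpExtension ℚ p) (γ : absoluteGaloisGroup ℚ), κ.IsCyclotomic → κ.IsTopGenerator γ →
        ∀ (I : IwasawaH1Data W p κ γ) (J : IwasawaH2Data W p κ γ I),
          W.analyticRank = 1 → p ≠ 2 → Addv W p → 0 ≤ padicValRat p W.j → ¬ p ∣ W.torsionOrder → Finite W.sha →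
          R W p →
          (∀ (Y : W.FineSelmerDualData κ γ⁻¹) (𝔮 : PrimeSpectrum (IwasawaAlgebra p)), 𝔮.asIdeal.height = 1 →
            Module.lengthAt (IwasawaAlgebra p) J.H2 𝔮 = Module.lengthAt (IwasawaAlgebra p) Y.X 𝔮) →
          KatoH2CountAt W p (Nat.card (coinvariants p J.H2)) := by
  intro W _ _ p _
  letI : ContinuousSMul ℤ_[p] (W.tateModule p) := TateModule.continuousSMul_padicInt
  intro κ γ hκ hγ I J hr hp2 hadd hj htors hsha hRW hpin
  obtain ⟨hmw, -⟩ := hGZK W (by rw [hr])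
  have hrank : W.mordellWeilRank = 1 := by rw [hmw, hr]
  haveI := hsha
  have hsha' : Finite (AddCommGroup.primaryComponent W.sha p) := inferInstance
  obtain ⟨hfg, ⟨htf, hrk⟩, -⟩ := h12 W p κ γ hκ hγ I
  haveI := hfg
  haveI := htf
  haveI : Nontrivial I.H := by
    by_contra hnt
    rw [not_nontrivial_iff_subsingleton] at hnt
    have h0 : Module.rank (IwasawaAlgebra p) I.H = 0 := rank_subsingleton' _ _
    rw [hrk] at h0
    exact one_ne_zero h0
  have hfix := finite_fixedPoints_kerSubgroup_inf_decomp W p hj κ hκ (primePlace p) (coe_primesEquiv_primePlace p)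
  obtain ⟨J₀, e₀, he₀, hfin₀⟩ := hH2X W p κ γ hγ (primePlace p) hp2 hκ (coe_primesEquiv_primePlace p) hfix I
  haveI := finite_coinvariants_H2_of_iwasawaH2Data W p J hrank hsha'
  haveI := finite_coinvariants_H2_of_iwasawaH2Data W p J₀ hrank hsha'
  exact (katoH2CountAt_iff_of_pinned_of_embedding W p hγ J hpin J₀ e₀ he₀ hfin₀).mpr
    (hX₀ W p κ γ hκ hγ I J₀ e₀ hr hp2 hadd hj htors hsha hRW he₀ hfin₀)

/-- **COUNT-X₀|R ⟸ {GZK, `Kato2004.thm12_4`} + COUNT-H2|R** for ANY row predicate `R` (Part 34's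
`countX₀_of_gzk_of_thm12_4_of_countH2` is the instance `R :=` the all-additive clause): the (H2ᶜ)-pinned twin `J₀^ι` over the
same pin is counted by COUNT-H2|R and Part 34 §2 carries the count back to `J₀`; H2X not needed.
[cite: Kato2004Asterisque, Thm. 12.4 (p. 221), (14.9.3) (p. 240), §14.14 (p. 243), Lemma 14.15 (p. 244)] [cite: Greenberg1989, §0 pp. 101–102] -/
theorem countX₀_of_gzk_of_thm12_4_of_countH2_of_rowPred (R : WeierstrassCurve ℚ → ℕ → Prop)
    (hGZK : rank_eq_analyticRank_of_analyticRank_le_one) (h12 : Kato2004.thm12_4)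
    (hH2 : ∀ (W : WeierstrassCurve ℚ) [W.IsElliptic] [W.IsGloballyMinimal] (p : ℕ) [Fact p.Prime],
      letI : ContinuousSMul ℤ_[p] (W.tateModule p) := TateModule.continuousSMul_padicInt
      ∀ (κ : ZpExtension ℚ p) (γ : absoluteGaloisGroup ℚ), κ.IsCyclotomic → κ.IsTopGenerator γ →
        ∀ (I : IwasawaH1Data W p κ γ) (J : IwasawaH2Data W p κ γ I),
          W.analyticRank = 1 → p ≠ 2 → Addv W p → 0 ≤ padicValRat p W.j → ¬ p ∣ W.torsionOrder → Finite W.sha →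
          R W p →
          (∀ (Y : W.FineSelmerDualData κ γ⁻¹) (𝔮 : PrimeSpectrum (IwasawaAlgebra p)), 𝔮.asIdeal.height = 1 →
            Module.lengthAt (IwasawaAlgebra p) J.H2 𝔮 = Module.lengthAt (IwasawaAlgebra p) Y.X 𝔮) →
          KatoH2CountAt W p (Nat.card (coinvariants p J.H2))) :
    ∀ (W : WeierstrassCurve ℚ) [W.IsElliptic] [W.IsGloballyMinimal] (p : ℕ) [Fact p.Prime],
      letI : ContinuousSMul ℤ_[p] (W.tateModule p) := TateModule.continuousSMul_padicInt
      ∀ (κ : ZpExtension ℚ p) (γ : absoluteGaloisGroup ℚ), κ.IsCyclotomic → (hγ : κ.IsTopGenerator γ) →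
        ∀ (I : IwasawaH1Data W p κ γ) (J₀ : IwasawaH2Data W p κ γ I)
          (e₀ : (W.fineSelmerDualData κ hγ).X →ₗ[IwasawaAlgebra p] J₀.H2),
          W.analyticRank = 1 → p ≠ 2 → Addv W p → 0 ≤ padicValRat p W.j → ¬ p ∣ W.torsionOrder → Finite W.sha →
          R W p →
          Function.Injective e₀ → Finite (J₀.H2 ⧸ LinearMap.range e₀) →
          KatoH2CountAt W p (Nat.card (coinvariants p J₀.H2)) := by
  intro W _ _ p _
  letI : ContinuousSMul ℤ_[p] (W.tateModule p) := TateModule.continuousSMul_padicInt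
  intro κ γ hκ hγ I J₀ e₀ hr hp2 hadd hj htors hsha hRW he₀ hfin₀
  obtain ⟨hmw, -⟩ := hGZK W (by rw [hr])
  have hrank : W.mordellWeilRank = 1 := by rw [hmw, hr]
  haveI := hsha
  have hsha' : Finite (AddCommGroup.primaryComponent W.sha p) := inferInstance
  obtain ⟨hfg, ⟨htf, hrk⟩, -⟩ := h12 W p κ γ hκ hγ I
  haveI := hfg
  haveI := htf
  haveI : Nontrivial I.H := by
    by_contra hnt
    rw [not_nontrivial_iff_subsingleton] at hnt
    have h0 : Module.rank (IwasawaAlgebra p) I.H = 0 := rank_subsingleton' _ _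
    rw [hrk] at h0
    exact one_ne_zero h0
  obtain ⟨J, -, -, hpin⟩ := exists_involTwist_pinned_contra_of_embedding W p hγ J₀ e₀ he₀ hfin₀
  haveI := finite_coinvariants_H2_of_iwasawaH2Data W p J hrank hsha'
  haveI := finite_coinvariants_H2_of_iwasawaH2Data W p J₀ hrank hsha'
  exact (katoH2CountAt_iff_of_pinned_of_embedding W p hγ J hpin J₀ e₀ he₀ hfin₀).mp
    (hH2 W p κ γ hκ hγ I J hr hp2 hadd hj htors hsha hRW hpin)

end RowPred

/-! ## §2 The CM instances -/

section CM

/-- **COUNT-H2|CM ⟸ {GZK, `Kato2004.thm12_4`, H2X} + COUNT-X₀|CM** (§1 at `R W p := W.HasCM`; COUNT-H2|CM = Part 33's display,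
COUNT-X₀|CM = the `hX₀` of Part 35's `rankOneCountReading_cm_of_facts`). [cite: Kato2004Asterisque, Thm. 12.4 (p. 221), (14.9.1) (p. 239),
(14.9.3) (p. 240), §14.14 (p. 243), Lemma 14.15 (p. 244)] [cite: Imai1975, Theorem (p. 12)] -/
theorem countH2_cm_of_gzk_of_thm12_4_of_h2x_of_countX₀_cm (hGZK : rank_eq_analyticRank_of_analyticRank_le_one)
    (h12 : Kato2004.thm12_4) (hH2X : exists_iwasawaH2Data_fineSelmerDual_embedding)
    (hX₀ : ∀ (W : WeierstrassCurve ℚ) [W.IsElliptic] [W.IsGloballyMinimal] (p : ℕ) [Fact p.Prime],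
      letI : ContinuousSMul ℤ_[p] (W.tateModule p) := TateModule.continuousSMul_padicInt
      ∀ (κ : ZpExtension ℚ p) (γ : absoluteGaloisGroup ℚ), κ.IsCyclotomic → (hγ : κ.IsTopGenerator γ) →
        ∀ (I : IwasawaH1Data W p κ γ) (J₀ : IwasawaH2Data W p κ γ I)
          (e₀ : (W.fineSelmerDualData κ hγ).X →ₗ[IwasawaAlgebra p] J₀.H2),
          W.analyticRank = 1 → p ≠ 2 → Addv W p → 0 ≤ padicValRat p W.j → ¬ p ∣ W.torsionOrder → Finite W.sha →
          W.HasCM →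
          Function.Injective e₀ → Finite (J₀.H2 ⧸ LinearMap.range e₀) →
          KatoH2CountAt W p (Nat.card (coinvariants p J₀.H2))) :
    ∀ (W : WeierstrassCurve ℚ) [W.IsElliptic] [W.IsGloballyMinimal] (p : ℕ) [Fact p.Prime],
      letI : ContinuousSMul ℤ_[p] (W.tateModule p) := TateModule.continuousSMul_padicInt
      ∀ (κ : ZpExtension ℚ p) (γ : absoluteGaloisGroup ℚ), κ.IsCyclotomic → κ.IsTopGenerator γ →
        ∀ (I : IwasawaH1Data W p κ γ) (J : IwasawaH2Data W p κ γ I),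
          W.analyticRank = 1 → p ≠ 2 → Addv W p → 0 ≤ padicValRat p W.j → ¬ p ∣ W.torsionOrder → Finite W.sha →
          W.HasCM →
          (∀ (Y : W.FineSelmerDualData κ γ⁻¹) (𝔮 : PrimeSpectrum (IwasawaAlgebra p)), 𝔮.asIdeal.height = 1 →
            Module.lengthAt (IwasawaAlgebra p) J.H2 𝔮 = Module.lengthAt (IwasawaAlgebra p) Y.X 𝔮) →
          KatoH2CountAt W p (Nat.card (coinvariants p J.H2)) :=
  countH2_of_gzk_of_thm12_4_of_h2x_of_countX₀_of_rowPred (fun W _ ↦ W.HasCM) hGZK h12 hH2X hX₀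

/-- **COUNT-X₀|CM ⟸ {GZK, `Kato2004.thm12_4`} + COUNT-H2|CM** (§1 at `R W p := W.HasCM`).  Hence on the CM rows, modulo
{GZK, `thm12_4`, H2X}: COUNT-X₀|CM ⟺ COUNT-H2|CM ⟺ COUNT-EC⁰|CM (Part 33). [cite: Kato2004Asterisque, Thm. 12.4 (p. 221),
(14.9.3) (p. 240), §14.14 (p. 243), Lemma 14.15 (p. 244)] [cite: Greenberg1989, §0 pp. 101–102] -/
theorem countX₀_cm_of_gzk_of_thm12_4_of_countH2_cm (hGZK : rank_eq_analyticRank_of_analyticRank_le_one)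
    (h12 : Kato2004.thm12_4)
    (hH2 : ∀ (W : WeierstrassCurve ℚ) [W.IsElliptic] [W.IsGloballyMinimal] (p : ℕ) [Fact p.Prime],
      letI : ContinuousSMul ℤ_[p] (W.tateModule p) := TateModule.continuousSMul_padicInt
      ∀ (κ : ZpExtension ℚ p) (γ : absoluteGaloisGroup ℚ), κ.IsCyclotomic → κ.IsTopGenerator γ →
        ∀ (I : IwasawaH1Data W p κ γ) (J : IwasawaH2Data W p κ γ I),
          W.analyticRank = 1 → p ≠ 2 → Addv W p → 0 ≤ padicValRat p W.j → ¬ p ∣ W.torsionOrder → Finite W.sha →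
          W.HasCM →
          (∀ (Y : W.FineSelmerDualData κ γ⁻¹) (𝔮 : PrimeSpectrum (IwasawaAlgebra p)), 𝔮.asIdeal.height = 1 →
            Module.lengthAt (IwasawaAlgebra p) J.H2 𝔮 = Module.lengthAt (IwasawaAlgebra p) Y.X 𝔮) →
          KatoH2CountAt W p (Nat.card (coinvariants p J.H2))) :
    ∀ (W : WeierstrassCurve ℚ) [W.IsElliptic] [W.IsGloballyMinimal] (p : ℕ) [Fact p.Prime],
      letI : ContinuousSMul ℤ_[p] (W.tateModule p) := TateModule.continuousSMul_padicInt
      ∀ (κ : ZpExtension ℚ p) (γ : absoluteGaloisGroup ℚ), κ.IsCyclotomic → (hγ : κ.IsTopGenerator γ) →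
        ∀ (I : IwasawaH1Data W p κ γ) (J₀ : IwasawaH2Data W p κ γ I)
          (e₀ : (W.fineSelmerDualData κ hγ).X →ₗ[IwasawaAlgebra p] J₀.H2),
          W.analyticRank = 1 → p ≠ 2 → Addv W p → 0 ≤ padicValRat p W.j → ¬ p ∣ W.torsionOrder → Finite W.sha →
          W.HasCM →
          Function.Injective e₀ → Finite (J₀.H2 ⧸ LinearMap.range e₀) →
          KatoH2CountAt W p (Nat.card (coinvariants p J₀.H2)) :=
  countX₀_of_gzk_of_thm12_4_of_countH2_of_rowPred (fun W _ ↦ W.HasCM) hGZK h12 hH2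

end CM

end Summit.BirchSwinnertonDyer.Rank1Residual.Additive.StrictCount

end
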